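import Literature.Analysis.FluidPDE.NSRobustnessOfRegularitySupNorm
import HarnessLib

/-!
# Robustness of regularity on `ℝ³`, smoothing vein I: the `H¹` slice inequality with half the
# dissipation kept, the force in `L²`, the Hessian–Laplacian bookkeeping

Analysis/FluidPDE proof file (theorems only; no definitions, no named facts, no `sorry`); fourth
file of the vein `NSRobustnessOfRegularity` (`H¹`) → `NSRobustnessOfRegularityH2` (`H²`) →
`NSRobustnessOfRegularitySupNorm`, preparing the `H¹ → H²` PARABOLIC SMOOTHING of the difference of
two classical solutions (`NSRobustnessOfRegularityDissipation`, `NSRobustnessOfRegularityH2Smoothing`):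
the `H²` defect `Z = Σᵢ∫|∇∂ᵢ(v − u)|²_F` at the END of a short window from `H¹ / L²` data only
(Constantin–Foias 1988 Ch. 10 / RRS 2016 Thm 6.8, the `t‖Au‖²` step, in Chebyshev form).

* `robustness_flux_le_strain_half_R3` — the `H¹` slice inequality of `robustness_flux_le_strain_R3`
  KEEPING HALF THE DISSIPATION: `−2νY + 2∫⟪(v·∇)w + (w·∇)u, Δw⟫ + 2∫⟪h, Δw⟫ ≤
  −νY + (4G + 3κσ₂)X + 4A⁴X³/ν³ + (4/ν)∫‖h‖² + (3σ₂/κ)L²` (the accepted lemma at viscosity `ν/2`;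
  no new slice calculus).
* `IsClassicalNSSolutionOn.lintegral_enorm_sq_force_slice_lt_top` — the force of a classical
  solution of the `L²`-Sobolev class is in `L²` on every slice (public copy of the vein's private
  lemma, generic time set).
* `sum_integral_frobeniusNormSq_fderiv_fderiv_eq_integral_laplacian_sq` — `Z = ∫‖Δw‖²` for a
  smooth field with `Dw, D²w, D³w ∈ L²` (the tree's Hessian–Laplacian identity, Stein 1970 III §1.3,
  in the vein's Frobenius bookkeeping): the `H²` defect IS the `H¹` dissipation density.

WHAT THIS IS NOT: not a statement about Navier–Stokes regularity or blow-up — slice calculus for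
given smooth fields. Consumer: cell `ns-blowup`, crux 20303 `EpisodeBaseT`, hybrid strain door.

## Mathlib / tree search

Tree: `robustness_flux_le_strain_R3`, `IsClassicalNSSolutionOn.lintegral_enorm_sq_fderiv_force_lt_top`
(the `Df` twin), `sum_sum_integral_sq_norm_fderiv_fderiv_eq_integral_sq_norm_laplacian`
(`EnstrophySplitting`), `frobeniusNormSq_eq_sum`, `norm_iteratedFDeriv_fderiv_apply_basisFun_le`.
Mathlib: `intervalIntegral.integral_finsetSum`-free bookkeeping via `integral_finsetSum`.

## References

* P. Constantin, C. Foias, *Navier–Stokes Equations*, Univ. Chicago Press 1988, Ch. 10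
  (parabolic smoothing of strong solutions, the `t‖Au‖²` estimate). [ConstantinFoias1988]
* J. C. Robinson, J. L. Rodrigo, W. Sadowski, *The Three-Dimensional Navier–Stokes Equations*,
  CUP 2016, Thm 6.8 (proof), Thm 9.1, Thm 1.20. [RobinsonRodrigoSadowskiCUP2016]
* M. Dashti, J. C. Robinson, SIAM J. Numer. Anal. 46 (2008) 3136–3150, Thm 2. [DashtiRobinson2008]
* E. M. Stein, *Singular Integrals and Differentiability Properties of Functions*, Princeton 1970,
  Ch. III §1.3. [Stein1971]
-/

noncomputable section

open MeasureTheory Set Function Filter Topology InnerProductSpace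
open scoped ENNReal NNReal ContDiff RealInnerProductSpace Laplacian

namespace Literature.Analysis.FluidPDE

/-! ## §A Bookkeeping repeated from the preceding files of the vein (private) -/

section Helpers

/-- `∫⁻‖a + b‖² < ∞` from `∫⁻‖a‖², ∫⁻‖b‖² < ∞`. [folklore] -/
private theorem h2s_lintegral_sq_add_lt_top {G : Type*} [NormedAddCommGroup G]
    {a b : EuclideanSpace ℝ (Fin 3) → G}
    (ham : AEStronglyMeasurable a volume) (ha : ∫⁻ x, ‖a x‖ₑ ^ 2 < ⊤)
    (hb : ∫⁻ x, ‖b x‖ₑ ^ 2 < ⊤) : ∫⁻ x, ‖a x + b x‖ₑ ^ 2 < ⊤ := by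
  have h := lintegral_enorm_sq_sub_le (g := fun x => -b x) ham (μ := volume)
  have e : ∀ x, a x + b x = a x - -b x := fun x => by rw [sub_neg_eq_add]
  simp_rw [e]
  refine lt_of_le_of_lt h ?_
  simp_rw [enorm_neg]
  exact ENNReal.add_lt_top.2 ⟨ENNReal.mul_lt_top (by simp) ha, ENNReal.mul_lt_top (by simp) hb⟩

/-- `∫⁻‖a − b‖² < ∞` from `∫⁻‖a‖², ∫⁻‖b‖² < ∞`. [folklore] -/
private theorem h2s_lintegral_sq_sub_lt_top {G : Type*} [NormedAddCommGroup G]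
    {a b : EuclideanSpace ℝ (Fin 3) → G}
    (ham : AEStronglyMeasurable a volume) (ha : ∫⁻ x, ‖a x‖ₑ ^ 2 < ⊤)
    (hb : ∫⁻ x, ‖b x‖ₑ ^ 2 < ⊤) : ∫⁻ x, ‖a x - b x‖ₑ ^ 2 < ⊤ :=
  lt_of_le_of_lt (lintegral_enorm_sq_sub_le (g := b) ham (μ := volume))
    (ENNReal.add_lt_top.2 ⟨ENNReal.mul_lt_top (by simp) ha, ENNReal.mul_lt_top (by simp) hb⟩)

/-- `∫⁻‖c • a‖² < ∞` from `∫⁻‖a‖² < ∞`. [folklore] -/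
private theorem h2s_lintegral_sq_smul_lt_top {G : Type*} [NormedAddCommGroup G] [NormedSpace ℝ G]
    {a : EuclideanSpace ℝ (Fin 3) → G} (c : ℝ) (ha : ∫⁻ x, ‖a x‖ₑ ^ 2 < ⊤) :
    ∫⁻ x, ‖c • a x‖ₑ ^ 2 < ⊤ := by
  have e : ∀ x, ‖c • a x‖ₑ ^ 2 = ‖c‖ₑ ^ 2 * ‖a x‖ₑ ^ 2 := fun x => by rw [enorm_smul, mul_pow]
  simp_rw [e]
  rw [lintegral_const_mul' _ _ (ENNReal.pow_ne_top enorm_ne_top)]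
  exact ENNReal.mul_lt_top (lt_top_iff_ne_top.2 (ENNReal.pow_ne_top enorm_ne_top)) ha

/-- `∫⁻‖c‖a‖‖² < ∞` from `∫⁻‖a‖² < ∞`. [folklore] -/
private theorem h2s_lintegral_sq_mul_norm_lt_top {G : Type*} [NormedAddCommGroup G]
    {a : EuclideanSpace ℝ (Fin 3) → G}
    (c : ℝ) (ha : ∫⁻ x, ‖a x‖ₑ ^ 2 < ⊤) : ∫⁻ x, ‖c * ‖a x‖‖ₑ ^ 2 < ⊤ := by
  have e : ∀ x, ‖c * ‖a x‖‖ₑ ^ 2 = ‖c‖ₑ ^ 2 * ‖a x‖ₑ ^ 2 := fun x => by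
    rw [enorm_mul, mul_pow, enorm_norm]
  simp_rw [e]
  rw [lintegral_const_mul' _ _ (ENNReal.pow_ne_top enorm_ne_top)]
  exact ENNReal.mul_lt_top (lt_top_iff_ne_top.2 (ENNReal.pow_ne_top enorm_ne_top)) ha

/-- Uniform-in-time Sobolev bound, at one time: `∫⁻‖Dⁿ(c t)‖² < ∞`. [folklore] -/
private theorem h2s_fin {F : Type*} [NormedAddCommGroup F] [NormedSpace ℝ F] {S : Set ℝ}
    {c : ℝ → EuclideanSpace ℝ (Fin 3) → F} {t : ℝ} (ht : t ∈ S) (n : ℕ)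
    (hC : ∃ C : ℝ≥0, ∀ s ∈ S, ∫⁻ x, ‖iteratedFDeriv ℝ n (c s) x‖ₑ ^ 2 ≤ C) :
    ∫⁻ x, ‖iteratedFDeriv ℝ n (c t) x‖ₑ ^ 2 < ⊤ := by
  obtain ⟨C, hC⟩ := hC
  exact lt_of_le_of_lt (hC t ht) ENNReal.coe_lt_top

/-- Order-zero Sobolev bound, unfolded: `∫⁻‖g‖² < ∞`. [folklore] -/
private theorem h2s_l2_of_order_zero {F : Type*} [NormedAddCommGroup F] [NormedSpace ℝ F]
    {g : EuclideanSpace ℝ (Fin 3) → F} {C : ℝ≥0} (h : ∫⁻ x, ‖iteratedFDeriv ℝ 0 g x‖ₑ ^ 2 ≤ C) :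
    ∫⁻ x, ‖g x‖ₑ ^ 2 < ⊤ := by
  refine lt_of_le_of_lt ((le_of_eq (lintegral_congr fun x => ?_)).trans h) ENNReal.coe_lt_top
  rw [← ofReal_norm, ← ofReal_norm, norm_iteratedFDeriv_zero]

end Helpers

/-! ## §B The `H¹` slice inequality keeping half the dissipation -/

section HalfFlux

/-- **The `H¹` slice inequality in strain form, KEEPING HALF THE DISSIPATION** (RRS 2016, proof of
Thm 9.1, Step 1, with the dissipation split `2ν = ν + ν`): in the setting of
`robustness_flux_le_strain_R3` (`u, w : ℝ³ → ℝ³` smooth, `div u = 0`, `X = ∫|∇w|²_F`,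
`Y = ∫‖Δw‖²`, `−⟪Du ξ, ξ⟫ ≤ G‖ξ‖²`, `‖D²u‖ ≤ σ₂`, `‖w‖_{L²} ≤ L`, free length `κ > 0`),
`−2νY + 2∫⟪(v·∇)w + (w·∇)u, Δw⟫ + 2∫⟪h, Δw⟫ ≤ −νY + (4G + 3κσ₂)X + 4A⁴X³/ν³ + (4/ν)∫‖h‖² + (3σ₂/κ)L²`
— the accepted inequality at viscosity `ν/2` plus `−νY` on both sides; it is the form that feeds a
DISSIPATION BUDGET `ν∫Y dt`. [cite: RobinsonRodrigoSadowskiCUP2016, Thm 9.1 (proof, Step 1, (9.2)–(9.3))] -/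
theorem robustness_flux_le_strain_half_R3 {ν : ℝ} (hν : 0 < ν)
    {u w h : EuclideanSpace ℝ (Fin 3) → EuclideanSpace ℝ (Fin 3)} (hu : ContDiff ℝ ∞ u)
    (hw : ContDiff ℝ ∞ w) (hh : Continuous h) (hdivu : VectorCalculus.IsDivFree u)
    (hw0 : ∫⁻ x, ‖iteratedFDeriv ℝ 0 w x‖ₑ ^ 2 < ⊤) (hw1 : ∫⁻ x, ‖iteratedFDeriv ℝ 1 w x‖ₑ ^ 2 < ⊤)
    (hw2 : ∫⁻ x, ‖iteratedFDeriv ℝ 2 w x‖ₑ ^ 2 < ⊤) (hw3 : ∫⁻ x, ‖iteratedFDeriv ℝ 3 w x‖ₑ ^ 2 < ⊤)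
    (hh0 : ∫⁻ x, ‖h x‖ₑ ^ 2 < ⊤) {B : ℝ} (hB : ∀ x, ‖u x‖ ≤ B)
    {B₁ : ℝ} (hB₁ : ∀ x, ‖fderiv ℝ u x‖ ≤ B₁)
    {G : ℝ} (hG : ∀ x (ξ : EuclideanSpace ℝ (Fin 3)), -⟪fderiv ℝ u x ξ, ξ⟫ ≤ G * ‖ξ‖ ^ 2)
    {σ₂ : ℝ} (hσ₂ : ∀ x, ‖iteratedFDeriv ℝ 2 u x‖ ≤ σ₂)
    {L : ℝ} (hL : Real.sqrt (∫ x, ‖w x‖ ^ 2) ≤ L) {κ : ℝ} (hκ : 0 < κ) :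
    -(2 * ν * ∫ x, ‖(Δ w) x‖ ^ 2) +
        2 * (∫ x, ⟪convect (fun y => u y + w y) w x + convect w u x, (Δ w) x⟫) +
        2 * (∫ x, ⟪h x, (Δ w) x⟫) ≤
      -(ν * ∫ x, ‖(Δ w) x‖ ^ 2) +
        ((4 * G + 3 * κ * σ₂) * (∫ x, frobeniusNormSq (fderiv ℝ w x)) +
          4 * agmonConst ^ 4 * (∫ x, frobeniusNormSq (fderiv ℝ w x)) ^ 3 / ν ^ 3 +
          4 / ν * (∫ x, ‖h x‖ ^ 2) + 3 * σ₂ / κ * L ^ 2) := by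
  have hν2 : 0 < ν / 2 := by positivity
  have key := robustness_flux_le_strain_R3 hν2 hu hw hh hdivu hw0 hw1 hw2 hw3 hh0 hB hB₁ hG hσ₂ hL hκ
  have e1 : agmonConst ^ 4 * (∫ x, frobeniusNormSq (fderiv ℝ w x)) ^ 3 / (2 * (ν / 2) ^ 3) =
      4 * agmonConst ^ 4 * (∫ x, frobeniusNormSq (fderiv ℝ w x)) ^ 3 / ν ^ 3 := by
    field_simp
    ring
  have e2 : 2 / (ν / 2) * (∫ x, ‖h x‖ ^ 2) = 4 / ν * (∫ x, ‖h x‖ ^ 2) := by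
    field_simp
    ring
  rw [e1, e2] at key
  have e3 : -(2 * (ν / 2) * ∫ x, ‖(Δ w) x‖ ^ 2) = -(ν * ∫ x, ‖(Δ w) x‖ ^ 2) := by ring
  rw [e3] at key
  linarith

end HalfFlux

/-! ## §C The force of a classical solution of the class is in `L²` on every slice -/

section ForceL2

variable {ν : ℝ} {S : Set ℝ} {f u : ℝ → EuclideanSpace ℝ (Fin 3) → EuclideanSpace ℝ (Fin 3)}
variable {p : ℝ → EuclideanSpace ℝ (Fin 3) → ℝ}

/-- **The force of a classical solution of the `L²`-Sobolev class is square integrable on every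
slice** (generic time set of unique differentiability): `f = ∂ₜu + (u·∇)u − νΔu + ∇p` with
`∂ₜu, Δu, ∇p ∈ L²` (class) and `‖(u·∇)u‖ ≤ ‖u‖_∞‖Du‖ ∈ L²` (`H² ⊂ C_B`). Public copy of the
vein's private lemma. [cite: RobinsonRodrigoSadowskiCUP2016, Thm 9.1 (setting) and Exercise 9.4] -/
theorem IsClassicalNSSolutionOn.lintegral_enorm_sq_force_slice_lt_top (hS : UniqueDiffOn ℝ S)
    (hu : IsClassicalNSSolutionOn S ν f u p) (hU : HasBoundedSobolevNormsOn S u)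
    (hUt : HasBoundedSobolevNormsOn S (timeDerivWithin S u))
    (hp : ∀ n : ℕ, ∃ C : ℝ≥0, ∀ t ∈ S, ∫⁻ x, ‖iteratedFDeriv ℝ n (p t) x‖ₑ ^ 2 ≤ C)
    {t : ℝ} (ht : t ∈ S) : ∫⁻ x, ‖f t x‖ₑ ^ 2 < ⊤ := by
  have hut : ContDiff ℝ ∞ (u t) := hu.contDiff_velocity ht
  have hut1 : ContDiff ℝ 1 (u t) := hut.of_le (by norm_cast)
  have cW : Continuous (timeDerivWithin S u t) :=
    ((hu.smooth_velocity.timeDerivWithin hS).contDiff_slice ht).continuous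
  have cΔ : Continuous (Δ (u t)) :=
    (contDiff_one_laplacian_of_contDiff_three (hut.of_le (by norm_cast))).continuous
  have cN : Continuous (convect (u t) (u t)) :=
    (hut1.continuous_fderiv one_ne_zero).clm_apply hut.continuous
  have hW0 : ∫⁻ x, ‖timeDerivWithin S u t x‖ₑ ^ 2 < ⊤ := by
    obtain ⟨C, hC⟩ := hUt 0
    exact h2s_l2_of_order_zero (hC t ht)
  have n_Δ : ∀ x, ‖(Δ (u t)) x‖ ≤ ‖(3 : ℝ) • iteratedFDeriv ℝ 2 (u t) x‖ := fun x => by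
    rw [norm_smul, Real.norm_of_nonneg (by norm_num : (0 : ℝ) ≤ 3)]
    exact norm_laplacian_le_three_mul_norm_iteratedFDeriv_two (hut.of_le (by norm_cast)) x
  have l2Δ : ∫⁻ x, ‖(Δ (u t)) x‖ₑ ^ 2 < ⊤ :=
    lintegral_enorm_sq_lt_top_of_norm_le n_Δ (h2s_lintegral_sq_smul_lt_top 3 (h2s_fin ht 2 (hU 2)))
  have n_gπ : ∀ x, ‖gradient (p t) x‖ = ‖iteratedFDeriv ℝ 1 (p t) x‖ := fun x => by
    rw [gradient, LinearIsometryEquiv.norm_map, ← norm_iteratedFDeriv_fderiv, norm_iteratedFDeriv_zero]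
  have l2gπ : ∫⁻ x, ‖gradient (p t) x‖ₑ ^ 2 < ⊤ :=
    lintegral_enorm_sq_lt_top_of_norm_le (fun x => (n_gπ x).le) (h2s_fin ht 1 (hp 1))
  have hD_eq : ∀ x, ‖fderiv ℝ (u t) x‖ = ‖iteratedFDeriv ℝ 1 (u t) x‖ := fun x => by
    rw [← norm_iteratedFDeriv_fderiv, norm_iteratedFDeriv_zero]
  have l2Du : ∫⁻ x, ‖fderiv ℝ (u t) x‖ₑ ^ 2 < ⊤ :=
    lintegral_enorm_sq_lt_top_of_norm_le (fun x => (hD_eq x).le) (h2s_fin ht 1 (hU 1))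
  obtain ⟨Bu, hBu⟩ := linfty_bound_of_hasBoundedSobolevNormsOn_holds
    (fun s hs => (hu.contDiff_velocity hs).of_le (by norm_cast)) hU
  have hBu0 : 0 ≤ Bu := (norm_nonneg _).trans (hBu t ht 0)
  have nN : ∀ x, ‖convect (u t) (u t) x‖ ≤ ‖Bu * ‖fderiv ℝ (u t) x‖‖ := fun x => by
    rw [convect, Real.norm_of_nonneg (mul_nonneg hBu0 (norm_nonneg _)), mul_comm]
    exact (fderiv ℝ (u t) x).le_opNorm_of_le (hBu t ht x)
  have l2N : ∫⁻ x, ‖convect (u t) (u t) x‖ₑ ^ 2 < ⊤ :=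
    lintegral_enorm_sq_lt_top_of_norm_le nN (h2s_lintegral_sq_mul_norm_lt_top Bu l2Du)
  have e : ∀ x, f t x = timeDerivWithin S u t x + convect (u t) (u t) x -
      ν • (Δ (u t)) x + gradient (p t) x := fun x => by
    rw [hu.momentum t ht x]
    abel
  have h1 := h2s_lintegral_sq_add_lt_top cW.aestronglyMeasurable hW0 l2N
  have h2 := h2s_lintegral_sq_sub_lt_top (cW.add cN).aestronglyMeasurable h1
    (h2s_lintegral_sq_smul_lt_top ν l2Δ)
  have h3 := h2s_lintegral_sq_add_lt_top ((cW.add cN).sub (cΔ.const_smul ν)).aestronglyMeasurable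
    h2 l2gπ
  refine lt_of_le_of_lt (le_of_eq (lintegral_congr fun x => ?_)) h3
  rw [e x]
  simp only [Pi.add_apply, Pi.sub_apply, Pi.smul_apply]

end ForceL2

/-! ## §D The `H²` defect is the `H¹` dissipation density: `Σᵢ∫|∇∂ᵢw|²_F = ∫‖Δw‖²` -/

section HessianLaplacian

/-- **`Σᵢ∫|∇∂ᵢw|²_F = ∫‖Δw‖²`** for a smooth field `w : ℝ³ → ℝ³` with `Dw, D²w, D³w ∈ L²` (the
Hessian–Laplacian identity `Σⱼ Σᵢ ‖∂ᵢ∂ⱼw‖²_{L²} = ‖Δw‖²_{L²}`, Stein 1970 Ch. III §1.3, in the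
Frobenius bookkeeping of the vein: `|∇∂ᵢw|²_F = Σⱼ‖∂ⱼ∂ᵢw‖²`). [cite: Stein1971, Ch. III §1.3 Prop 3] -/
theorem sum_integral_frobeniusNormSq_fderiv_fderiv_eq_integral_laplacian_sq
    {w : EuclideanSpace ℝ (Fin 3) → EuclideanSpace ℝ (Fin 3)} (hw : ContDiff ℝ ∞ w)
    (hw1 : ∫⁻ x, ‖iteratedFDeriv ℝ 1 w x‖ₑ ^ 2 < ⊤) (hw2 : ∫⁻ x, ‖iteratedFDeriv ℝ 2 w x‖ₑ ^ 2 < ⊤)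
    (hw3 : ∫⁻ x, ‖iteratedFDeriv ℝ 3 w x‖ₑ ^ 2 < ⊤) :
    (∑ i, ∫ x, frobeniusNormSq
        (fderiv ℝ (fun y => fderiv ℝ w y (EuclideanSpace.basisFun (Fin 3) ℝ i)) x)) =
      ∫ x, ‖(Δ w) x‖ ^ 2 := by
  set e := EuclideanSpace.basisFun (Fin 3) ℝ with he
  have he1 : ∀ i, ‖e i‖ = 1 := fun i => by simp [he]
  have hw3' : ContDiff ℝ 3 w := hw.of_le (by norm_cast)
  -- the slices `wᵢ = ∂ᵢ w` are `C²` with `L²` second derivatives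
  have hwi : ∀ i, ContDiff ℝ 2 (fun y => fderiv ℝ w y (e i)) := fun i =>
    ((hw3'.fderiv_right (m := 2) (by norm_num)).clm_apply contDiff_const)
  have hint : ∀ i j, Integrable (fun x => ‖fderiv ℝ (fun y => fderiv ℝ w y (e i)) x (e j)‖ ^ 2)
      volume := by
    intro i j
    have hc : Continuous fun x => fderiv ℝ (fun y => fderiv ℝ w y (e i)) x (e j) :=
      (((hwi i).continuous_fderiv (by norm_num)).clm_apply continuous_const)
    refine integrable_sq_norm_of_lintegral_lt_top hc (lintegral_enorm_sq_lt_top_of_norm_le ?_ hw2)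
    intro x
    calc ‖fderiv ℝ (fun y => fderiv ℝ w y (e i)) x (e j)‖
        ≤ ‖fderiv ℝ (fun y => fderiv ℝ w y (e i)) x‖ * ‖e j‖ := ContinuousLinearMap.le_opNorm _ _
      _ = ‖iteratedFDeriv ℝ 1 (fun y => fderiv ℝ w y (e i)) x‖ := by
          rw [he1, mul_one, ← norm_iteratedFDeriv_fderiv, norm_iteratedFDeriv_zero]
      _ ≤ ‖iteratedFDeriv ℝ 2 w x‖ :=
          norm_iteratedFDeriv_fderiv_apply_basisFun_le hw 1 (by exact_mod_cast le_top) x i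
  have hfrob : ∀ i, (∫ x, frobeniusNormSq (fderiv ℝ (fun y => fderiv ℝ w y (e i)) x)) =
      ∑ j, ∫ x, ‖fderiv ℝ (fun y => fderiv ℝ w y (e i)) x (e j)‖ ^ 2 := by
    intro i
    rw [← integral_finsetSum _ fun j _ => hint i j]
    exact integral_congr_ae (Eventually.of_forall fun x => frobeniusNormSq_eq_sum e _)
  rw [Finset.sum_congr rfl fun i _ => hfrob i]
  exact sum_sum_integral_sq_norm_fderiv_fderiv_eq_integral_sq_norm_laplacian hw3' hw1 hw2 hw3

end HessianLaplacian


end Literature.Analysis.FluidPDE
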